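import Mathlib
import HarnessLib
import Summits.Langlands.Langlands.Theses.SkinnerWilesDefectOne
import Summits.Langlands.Langlands.Theorems.SkinnerWilesDefectOneReducibleOrdinaryProModularDefs
import Literature.NumberTheory.GaloisRepresentations.NearlyOrdinaryDeformationRing

/-!
# Pro-modular primes of `R_𝒟`: going up (specialisation of pro-modularity)

Route `SkinnerWilesDefectOne`, support item stmt-Langlands-14718
(`ProModularOfEisensteinSeed : EisensteinProModularSeed → ReducibleOrdinaryProModular`, Skinner–Wiles
steps (I)+(III) at defect one).  In Skinner–Wiles' propagation of pro-modularity along the nearly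
ordinary deformation ring ([SW, §4.1, p. 62]: "It is immediate from the above definition that if `𝔮` is
a pro-modular prime of `R_𝒟` and if `𝔭 ⊇ 𝔮` is another prime ideal, then `𝔭` is also pro-modular.  In
particular, if a minimal prime of `R_𝒟` is pro-modular, then so is every prime ideal on the corresponding
irreducible component of `spec(R_𝒟)`.  In this case we say that the component is pro-modular." — used in
step (III), proof of Prop. 4.1) the formal content is:

**pro-modularity of a prime `𝔮` of `R_𝒟` at tame level `𝒰` passes to every prime `𝔭 ⊇ 𝔮`**
(`IsProModularPrimeAt.of_le`): compose the continuous point `x : 𝕋(𝒰) → R/𝔮` with the canonical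
surjection `R/𝔮 → R/𝔭` (continuous for the `𝔪_R`-adic topologies, `continuous_factor_adic`), push
unramifiedness and the Hecke–Frobenius characteristic polynomials of `ρ_𝒟 mod 𝔮` forward
(`modPrime_eq_map_factor_comp`, `heckeFrobPoly_map`).  This is the "going UP" step (4) of stub S4 and the
last Galois-side step of stub S5 of line `steinberg_hyperplane` (generic point of `C_ρ` pro-modular ⟹
`𝔭_ρ` pro-modular), in the line's own vocabulary `IsProModularPrimeAt`
(`Theorems/SkinnerWilesDefectOneReducibleOrdinaryProModularDefs.lean`).  The converse direction (down
to the primes BELOW a nice prime) is Skinner–Wiles' property (P1), i.e. the patching argument, and is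
not touched here.

References: C. M. Skinner, A. J. Wiles, *Residually reducible representations and modular forms*,
Publ. Math. IHÉS 89 (1999), §4.1 (pro-modular primes, (4.1), p. 62) and §4.3 (proof of Prop. 4.1, step
one). [SkinnerWiles1999]
-/

set_option linter.dupNamespace false -- project-wide option (lakefile weak.linter.dupNamespace); `Summit.Langlands.Langlands` is the mandated namespace

namespace Summit.Langlands.Langlands.Cruxes.ReducibleOrdinaryProModular.SteinbergHyperplane

open scoped NumberField MatrixGroups
open IsDedekindDomain Field Polynomial Matrix IsLocalRing
open Literature.NumberTheory.Automorphic Literature.NumberTheory.Automorphic.BigHeckeGLn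
open Literature.NumberTheory.GaloisRepresentations

noncomputable section

/-! ### Coefficient changes -/

/-- `heckeFrobPoly` is compatible with ring homomorphisms (coefficientwise). [folklore] -/
theorem heckeFrobPoly_map {A B : Type*} [CommRing A] [CommRing B] (g : A →+* B) (n q : ℕ)
    (a : ℕ → A) :
    (heckeFrobPoly n q a).map g = heckeFrobPoly n q (fun i => g (a i)) := by
  simp [heckeFrobPoly, Polynomial.map_sum]

/-- **The canonical surjection `R/𝔮 → R/𝔭` (`𝔮 ≤ 𝔭`) is continuous for the `𝔪`-adic topologies**
(`𝔪` any ideal of `R`, pushed to the two quotients): it maps `𝔪·(R/𝔮)` onto `𝔪·(R/𝔭)`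
(Mathlib `WithIdeal.uniformContinuous_of_map_le`). [folklore] -/
theorem continuous_factor_adic {R : Type*} [CommRing R] (𝔪 : Ideal R) {𝔮 𝔭 : Ideal R}
    (h : 𝔮 ≤ 𝔭) :
    @Continuous (R ⧸ 𝔮) (R ⧸ 𝔭) (𝔪.map (Ideal.Quotient.mk 𝔮)).adicTopology
      (𝔪.map (Ideal.Quotient.mk 𝔭)).adicTopology (Ideal.Quotient.factor h) := by
  letI : WithIdeal (R ⧸ 𝔮) := ⟨𝔪.map (Ideal.Quotient.mk 𝔮)⟩
  letI : WithIdeal (R ⧸ 𝔭) := ⟨𝔪.map (Ideal.Quotient.mk 𝔭)⟩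
  have hle : (WithIdeal.i (R := R ⧸ 𝔮)).map (Ideal.Quotient.factor h) ≤ WithIdeal.i (R := R ⧸ 𝔭) := by
    change (𝔪.map (Ideal.Quotient.mk 𝔮)).map (Ideal.Quotient.factor h) ≤ 𝔪.map (Ideal.Quotient.mk 𝔭)
    rw [Ideal.map_map, Ideal.Quotient.factor_comp_mk]
  exact (WithIdeal.uniformContinuous_of_map_le hle).continuous

variable {F : Type} [Field F] [NumberField F] {p : ℕ} [Fact p.Prime]
variable {𝒪 : Type} [CommRing 𝒪] {k : Type} [Field k] [Algebra 𝒪 k] {𝒟 : NearlyOrdinaryDatum F p 𝒪 k}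
variable (𝓡 : NearlyOrdinaryDeformationRing.{0} 𝒟)

omit [Fact p.Prime] in
/-- `ρ_𝒟 mod 𝔭` is the push-forward of `ρ_𝒟 mod 𝔮` along `R/𝔮 → R/𝔭` for `𝔮 ≤ 𝔭`. [folklore] -/
theorem modPrime_eq_map_factor_comp {𝔮 𝔭 : PrimeSpectrum 𝓡.R} (h : 𝔮.asIdeal ≤ 𝔭.asIdeal) :
    𝓡.modPrime 𝔭 = (Matrix.GeneralLinearGroup.map (Ideal.Quotient.factor h)).comp (𝓡.modPrime 𝔮) := by
  rw [NearlyOrdinaryDeformationRing.modPrime, NearlyOrdinaryDeformationRing.modPrime,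
    ← MonoidHom.comp_assoc, ← Matrix.GeneralLinearGroup.map_comp, Ideal.Quotient.factor_comp_mk]

omit [Fact p.Prime] in
/-- Unramifiedness of `ρ_𝒟 mod 𝔮` at `v` passes to `ρ_𝒟 mod 𝔭` for `𝔭 ⊇ 𝔮`. [folklore] -/
theorem isUnramifiedAt_modPrime_of_le {𝔮 𝔭 : PrimeSpectrum 𝓡.R} (h : 𝔮.asIdeal ≤ 𝔭.asIdeal)
    {v : HeightOneSpectrum (𝓞 F)} (hv : Deformation.IsUnramifiedAt v (𝓡.modPrime 𝔮)) :
    Deformation.IsUnramifiedAt v (𝓡.modPrime 𝔭) := by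
  intro 𝔓 h𝔓 σ hσ
  rw [modPrime_eq_map_factor_comp 𝓡 h, MonoidHom.comp_apply, hv 𝔓 h𝔓 σ hσ, map_one]

omit [Fact p.Prime] in
/-- The characteristic polynomial of `(ρ_𝒟 mod 𝔭)(σ)` is the image of that of `(ρ_𝒟 mod 𝔮)(σ)`,
`𝔮 ≤ 𝔭`. [folklore] -/
theorem charpoly_modPrime_of_le {𝔮 𝔭 : PrimeSpectrum 𝓡.R} (h : 𝔮.asIdeal ≤ 𝔭.asIdeal)
    (σ : absoluteGaloisGroup F) :
    (𝓡.modPrime 𝔭 σ).val.charpoly = ((𝓡.modPrime 𝔮 σ).val.charpoly).map (Ideal.Quotient.factor h) := by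
  rw [modPrime_eq_map_factor_comp 𝓡 h, MonoidHom.comp_apply, ← Matrix.charpoly_map]
  rfl

/-- **Going up for pro-modular primes** ([SW, §4.1, p. 62]: "if `𝔮` is a pro-modular prime of `R_𝒟`
and if `𝔭 ⊇ 𝔮` is another prime ideal, then `𝔭` is also pro-modular"): if the prime `𝔮` of `R_𝒟` is
pro-modular at the
tame level `𝒰` (a continuous point `x : 𝕋(𝒰) → R/𝔮` with which `ρ_𝒟 mod 𝔮` is associated), then so
is every prime `𝔭 ⊇ 𝔮`, with the point `(R/𝔮 → R/𝔭) ∘ x`.  In Skinner–Wiles' step (III) this carries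
pro-modularity from a minimal prime of a component to every prime of the component, and in stub S5 of
`steinberg_hyperplane` from the generic point of `C_ρ` to `𝔭_ρ`.
[cite: SkinnerWiles1999, §4.1 p. 62; §4.3 proof of Prop. 4.1] -/
theorem IsProModularPrimeAt.of_le {𝒰 : TameLevel 2 F p} {𝔮 𝔭 : PrimeSpectrum 𝓡.R}
    (h : 𝔮 ≤ 𝔭) (h𝔮 : IsProModularPrimeAt 𝓡 𝒰 𝔮) : IsProModularPrimeAt 𝓡 𝒰 𝔭 := by
  have hle : 𝔮.asIdeal ≤ 𝔭.asIdeal := (PrimeSpectrum.asIdeal_le_asIdeal 𝔮 𝔭).mpr h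
  obtain ⟨x, hx, hass⟩ := h𝔮
  refine ⟨(Ideal.Quotient.factor hle).comp x, ?_, fun v hv => ?_⟩
  · exact @Continuous.comp _ _ _ _
      ((maximalIdeal 𝓡.R).map (Ideal.Quotient.mk 𝔮.asIdeal)).adicTopology
      ((maximalIdeal 𝓡.R).map (Ideal.Quotient.mk 𝔭.asIdeal)).adicTopology _ _
      (continuous_factor_adic (maximalIdeal 𝓡.R) hle) hx
  · obtain ⟨hunr, hchar⟩ := hass v hv
    refine ⟨isUnramifiedAt_modPrime_of_le 𝓡 hle hunr, fun 𝔓 h𝔓 σ hσ => ?_⟩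
    rw [charpoly_modPrime_of_le 𝓡 hle σ, hchar 𝔓 h𝔓 σ hσ, heckeFrobPoly_map]
    rfl

/-- **All primes of a pro-modular component are pro-modular**: if a minimal prime (or any prime) `𝔮`
of `R_𝒟` is pro-modular at level `𝒰`, so is every point of its closure `V(𝔮)` — the form in which
Skinner–Wiles use going-up ("if a minimal prime of `R_𝒟` is pro-modular, then so is every prime ideal on
the corresponding irreducible component … we say that the component is pro-modular").
[cite: SkinnerWiles1999, §4.1 p. 62] -/
theorem IsProModularPrimeAt.forall_of_mem_zeroLocus {𝒰 : TameLevel 2 F p} {𝔮 : PrimeSpectrum 𝓡.R}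
    (h𝔮 : IsProModularPrimeAt 𝓡 𝒰 𝔮) :
    ∀ 𝔭 ∈ PrimeSpectrum.zeroLocus (𝔮.asIdeal : Set 𝓡.R), IsProModularPrimeAt 𝓡 𝒰 𝔭 :=
  fun 𝔭 h𝔭 => IsProModularPrimeAt.of_le 𝓡 ((PrimeSpectrum.asIdeal_le_asIdeal 𝔮 𝔭).mp h𝔭) h𝔮

end

end Summit.Langlands.Langlands.Cruxes.ReducibleOrdinaryProModular.SteinbergHyperplane
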